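import Literature.MathematicalPhysics.QuantumFieldTheory.Balaban1983to89.B4Prop31Energy
import Literature.MathematicalPhysics.QuantumFieldTheory.Balaban1983to89.B4Prop31Averaging
import Literature.MathematicalPhysics.QuantumFieldTheory.Balaban1983to89.B2Sect3AGaussianStep

/-!
# `Balaban1983to89.B4Prop31Regular` — T. Bałaban, *Regularity and decay of lattice Green's functions*, Commun. Math.
Phys. **89** (1983) 571–597 [Balaban1983RegularityDecay] (= [B4]): «Proposition 3.1′ of [2]» (1.21)–(1.22) p. 574
FOR REGULAR NON-ZERO VECTOR FIELDS — file 3c/3: the lower bound (1.22) for the quadratic form of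
`Δ^{(k)}(Ω,A) = a_kI − a_k²Q_k(A)G_k(Ω,A)Q_k^*(A)` on every finite union of unit blocks, and the DAG leaf
`B4.Prop31Printed` PROVED on the concrete regular-region family `(n, Ω^{(k)}, e, A)` (kind «model-instance»)

statement-level skeleton of published theorems with citation tags; proofs where landed; nothing here is a claim about
the Yang–Mills mass gap

PDF held: `paper:balaban1983-cmp89-regularity-decay` (journal page = PDF page + 570); pp. 572–574 [PDF 2–4], 589–593
[PDF 19–23] read.

CITATION HEADER (lean-in-tree rule).  Phase-2 PROOF file of the lit-balaban typed skeleton (HOME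
`run/shared/lean/pub/lit-balaban/`), SKELETON row **`B4.Prop3.1'[II]`** = `B4.Prop31Printed` («Proposition 3.1′ of
[2]», owner r01, referee ref-4; before this file proved only at `A = 0`, `B4Prop31Zero.prop31Printed_zeroField`),
seat p35 gen 2 (unit `lit-balaban-p35`).  Inputs (all PROVED, used by name): `B4Prop31Energy` (variational
representation `⟨ψ, Δ^{(k)}ψ⟩ = F(Φ⋆, ψ)`, (4.1)–(4.3)), `B4Prop31Averaging.covDiffSq_le` (covariant averaging
inequality), `B4Prop31Holonomy.abs_loopSum_le` (holonomy bound from (1.21)), `B4Lower18RegularRegion`'s (1.8) for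
regular fields on unions of unit blocks (`lower18_regular_region_stair`, `regular17_blockwise`) and
`B2Sect3AGaussianStep.one_add_log_inv_rpow_mul_rpow_le` (`(1 + log e⁻¹)^p e^s ≤ max(1,p/s)^p`).

THE PRINTED STATEMENT (p. 574 [PDF 4], verbatim up to OCR): *"Proposition 3.1′ of [2]: Let Ω be a sum of unit blocks
(i.e. Ω^{(k)} is an arbitrary subset of Z^d) and let A satisfies the condition |(∂^η_μA)(x)| ≤ O(1)p(e) (p(e) =
a₀(1 + log e^{−1})^p), (1.21) then there exists a positive constant γ₀ depending on d only, such that for e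
sufficiently small ⟨φ, Δ^{(k)}(Ω,A)φ⟩ ≥ γ₀(Σ_{⟨x,x′⟩⊂Ω^{(k)}}|U(A(⟨x,x′⟩))φ(x′) − φ(x)|² + m²Σ_{x∈Ω^{(k)}}|φ(x)|²) −
O(1)e^{2−α}Σ_{x∈Ω^{(k)}}|φ(x)|² (1.22) for arbitrary α > 0 and a constant O(1) depending on α and the other
constants, but independent of Ω, k, A, and for an arbitrary function φ."*

ROUTE (recorded deviation from the printed proof §4 pp. 589–593).  The print localises to two-block operators
`Δ(x,x′)` via `2d` matchings (4.5)–(4.7), expands `A = A₀ + A′` to first order (4.8)–(4.11) importing Lemma II.2.4 and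
(I.3.15)/(I.3.44) of [1, 2] (census G-B4-06/07), and computes the constant-field two-block form by duality
(4.12)–(4.22) (G-B4-08).  This file keeps the SAME variational/duality mechanism ((4.1)–(4.3), (4.15)–(4.18): `⟨ψ,
Δ^{(k)}ψ⟩ = inf_Φ [η^{d+1}⟨Φ,(−Δ_A + m²)Φ⟩ + a_k|ψ − Q_k(A)Φ|²]`, attained at `Φ⋆ = a_kG_kQ_k^*ψ`) but GLOBALLY on
`Ω`, and replaces the first-order expansion by an exact covariant telescoping along the prisms `Γ_{y,x} ∪ [x,x′] ∪
Γ_{y′,x′} ∪ ⟨y′,y⟩` whose abelian holonomy is bounded through (1.21) (`|e^{iκΛ} − 1| ≤ ℓκ|Λ|`,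
`κ|Λ| ≤ (3d+4)·O(1)·e·p(e)`), plus (1.8) for the size of `Φ⋆`; the printed error `O(1)e²p²(e) ≤ C(α)e^{2−α}` then
comes out the same way.  No statement of [1, 2] is used.

WHAT IS KERNEL-CHECKED (zero `sorry`, standard axioms; no new `Prop`-valued statement):
* `form122_lattice` — (1.22) IN LATTICE UNITS with explicit constants: for a Lipschitz orthogonal flow (`|(U(t)−1)v|²
  ≤ (ℓt)²|v|²`), `a > 0`, `m² ≥ 0`, ANY `n ≥ 1`, ANY finite `Ω^{(k)} ⊂ ℤ^{d+1}`, any vector field with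
  `|A_ν(x+e_μ) − A_ν(x)| ≤ δ` on `Ω` and `|κ|(d+1)nδ ≤ θ/n`, `ℓ²θ²(d+1)(1+a(d+1)) ≤ min(2,a)/4`:
  `γ₀(E_A(ψ) + m²|ψ|²) − γ₀·6(d+1)(a/γ_H)²(ℓ|κ|(3d+4)n²δ)²·|ψ|² ≤ ⟨ψ, Δ^{(k)}(Ω,A)ψ⟩`, `γ₀ = 1/max((6(d+1)+2m²)/a,
  24)`, `γ_H = min(2,a)/4 + m²`;
* `regularFormSetting` — the concrete `B4.FormSetting` carriers indexed by `(n, Ω^{(k)}, e, A)` with `κ = e/n`,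
  `reg121 :=` (1.21) in lattice units `|A_ν(x+e_μ) − A_ν(x)| ≤ C·p(e)/n`, `p(e) = a₀(1 + log e⁻¹)^p` (`B2.pFn`);
* **`prop31Printed_regularRegion`**: `B4.Prop31Printed (regularFormSetting F a m² C a₀ p)` for every Lipschitz
  orthogonal flow, `a > 0`, `m² ≥ 0`, `C, a₀ ≥ 0`, `p > 0`, with `γ₀` as above, `e₁ = min(1, e₁(ℓ,(d+1)Ca₀max(1,2p)^p,
  a, ½))` of `B4Lower18Regular.threshold_exists`, and `C(α) = γ₀·6(d+1)(a/γ_H)²ℓ²((3d+4)Ca₀)²max(1,2p/α)^{2p}`;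
  `prop31Printed_regularRegion_rot` — the hypothesis-free instance for the rotation flow (`N = 2`, `ℓ = 1`).
HONEST LABELS: `γ₀`'s dependence on `(a, m²)` (print: «depending on d only», cf. the printed proof's own «if m² ≤
O(1)» at (4.4)) and all constants are the lineage's; [B4]'s `Ω` are unions of big blocks inside a torus/box — here
`Ω^{(k)}` is an arbitrary finite subset of `ℤ^{d+1}` with Neumann bonds of `Ω`, as (1.22) states.
Unit `lit-balaban-p35` (gen 2), HOME as above.
-/

namespace Literature.MathematicalPhysics.QuantumFieldTheory.Balaban1983to89.B4Prop31Regular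

open Matrix Finset
open Literature.MathematicalPhysics.QuantumFieldTheory.Balaban1983to89.B4GaugeCovariance
open Literature.MathematicalPhysics.QuantumFieldTheory.Balaban1983to89.B4Lower18Regular
  (dotProduct_self_nonneg' isUnit_det_of_form_ge threshold_exists rot_lipschitz e1)
open Literature.MathematicalPhysics.QuantumFieldTheory.Balaban1983to89.B4Lower18RegularRegion
  (regWt regWt_nonneg rBlkWt rBlkWt_nonneg sum_rBlkWt_row sum_rBlkWt_col rbaseEmb rstairContour compField
    blockConst baseConst regular17_blockwise lower18_regular_region_stair)
open Literature.MathematicalPhysics.QuantumFieldTheory.Balaban1983to89.B4Reflection242 (nbrs blk)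
open Literature.MathematicalPhysics.QuantumFieldTheory.Balaban1983to89.B4Lower18 (fineDom)
open Literature.MathematicalPhysics.QuantumFieldTheory.Balaban1983to89.B4Prop31Energy
open Literature.MathematicalPhysics.QuantumFieldTheory.Balaban1983to89.B4Prop31Holonomy (loopSum abs_loopSum_le)
open Literature.MathematicalPhysics.QuantumFieldTheory.Balaban1983to89.B4Prop31Charts
open Literature.MathematicalPhysics.QuantumFieldTheory.Balaban1983to89.B4Prop31Averaging (covDiffSq_le)
open Literature.MathematicalPhysics.QuantumFieldTheory.Balaban1983to89.B2 (pFn)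
open Literature.MathematicalPhysics.QuantumFieldTheory.Balaban1983to89.B2Sect3AGaussianStep
  (one_add_log_inv_rpow_mul_rpow_le)

noncomputable section

section Lattice

variable {ι : Type*} [Fintype ι] [DecidableEq ι] {d : ℕ}

/-- the quadratic form (1.3) of `−Δ^{η,N}_{A,Ω}` is non-negative. [cite: Balaban1983RegularityDecay, p. 572 (1.3)] -/
theorem covLap_form_nonneg_region (F : OrthFlow ι) (κ : ℝ) (n : ℕ) (Ωc : Finset (Fin (d + 1) → ℤ))
    (Ac : (Fin (d + 1) → ℤ) → Fin (d + 1) → ℝ) (Φ : ↥(fineDom n Ωc) × ι → ℝ) :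
    0 ≤ Φ ⬝ᵥ (covLap (regWt n (fineDom n Ωc)) (linkR F κ n Ωc Ac) *ᵥ Φ) := by
  rw [covLap_form]
  exact Finset.sum_nonneg fun x _ => Finset.sum_nonneg fun y _ =>
    mul_nonneg (regWt_nonneg n (fineDom n Ωc) x y) (dotProduct_self_nonneg' _)

/-- `E + M ≤ c₁F + XS` with `c₁ > 0` gives `c₁⁻¹(E + M) − c₁⁻¹XS ≤ F`. [folklore] -/
private theorem final_step {c₁ E M Fm Z X S : ℝ} (hc₁ : 0 < c₁) (h : E + M ≤ c₁ * Fm + Z) (hZ : Z = X * S) :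
    c₁⁻¹ * (E + M) - c₁⁻¹ * X * S ≤ Fm := by
  rw [hZ] at h
  have h1 : c₁⁻¹ * (E + M) ≤ c₁⁻¹ * (c₁ * Fm + X * S) := mul_le_mul_of_nonneg_left h (inv_nonneg.2 hc₁.le)
  have h2 : c₁⁻¹ * (c₁ * Fm + X * S) = Fm + c₁⁻¹ * X * S := by
    rw [mul_add, ← mul_assoc, inv_mul_cancel₀ hc₁.ne', one_mul, mul_assoc]
  linarith

/-- **(1.22) IN LATTICE UNITS, EXPLICIT CONSTANTS** (regular `A ≠ 0`, every finite union of unit blocks): with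
`E_A(ψ) = Σ_{⟨y,y′⟩⊂Ω^{(k)}}|U(A(⟨y,y′⟩))ψ(y′) − ψ(y)|²`, `γ₀ = 1/max((6(d+1)+2m²)/a, 24)`, `γ_H = min(2,a)/4 + m²`,
under `|A_ν(x+e_μ) − A_ν(x)| ≤ δ` on `Ω`, `|κ|(d+1)nδ ≤ θ/n` and the smallness of (1.8):
`γ₀(E_A(ψ) + m²|ψ|²) − γ₀·6(d+1)(a/γ_H)²(ℓ|κ|(3d+4)n²δ)²|ψ|² ≤ ⟨ψ, Δ^{(k)}(Ω,A)ψ⟩`.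
[cite: Balaban1983RegularityDecay, p. 574 (1.22); proof pp. 589–593 (4.1)–(4.4), (4.7)] -/
theorem form122_lattice (F : OrthFlow ι) {ℓ : ℝ} (hℓ : 0 ≤ ℓ)
    (hLip : ∀ t (v : ι → ℝ), ((F.U t - 1) *ᵥ v) ⬝ᵥ ((F.U t - 1) *ᵥ v) ≤ (ℓ * t) ^ 2 * (v ⬝ᵥ v))
    (κ : ℝ) {n : ℕ} (hn : 1 ≤ n) {a : ℝ} (ha : 0 < a) {m2 : ℝ} (hm : 0 ≤ m2) (Ωc : Finset (Fin (d + 1) → ℤ))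
    (Ac : (Fin (d + 1) → ℤ) → Fin (d + 1) → ℝ) {δ θ : ℝ} (hδ : 0 ≤ δ) (hθ : 0 ≤ θ)
    (h121 : ∀ x ∈ fineDom n Ωc, ∀ μ ν : Fin (d + 1), |Ac (x + e1 μ) ν - Ac x ν| ≤ δ)
    (hκθ : |κ| * ((d + 1) * n * δ) ≤ θ / n)
    (hsmall : ℓ ^ 2 * θ ^ 2 * (d + 1) * (1 + a * (d + 1)) ≤ min 2 a / 4)
    (ψ : ↥Ωc × ι → ℝ) :
    (max ((6 * (d + 1) + 2 * m2) / a) 24)⁻¹ * (covDiffSq F κ Ac n Ωc ψ + m2 * (ψ ⬝ᵥ ψ))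
        - (max ((6 * (d + 1) + 2 * m2) / a) 24)⁻¹ *
            (6 * (d + 1) * (a / (min 2 a / 4 + m2)) ^ 2 * (ℓ * (|κ| * ((3 * d + 4) * n ^ 2 * δ))) ^ 2) *
          (ψ ⬝ᵥ ψ)
      ≤ ψ ⬝ᵥ (keff (regWt n (fineDom n Ωc)) m2 a ((n : ℝ) ^ (d + 1))⁻¹ (rBlkWt n Ωc (fineDom n Ωc))
          (linkR F κ n Ωc Ac) (transR F κ hn Ωc Ac) *ᵥ ψ) := by
  have hn0 : (0 : ℝ) < n := by exact_mod_cast hn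
  have hs : (0 : ℝ) ≤ ((n : ℝ) ^ (d + 1))⁻¹ := by positivity
  have hsN : ((n : ℝ) ^ (d + 1))⁻¹ * (n : ℝ) ^ (d + 1) ≤ 1 := by rw [inv_mul_cancel₀ (by positivity)]
  have hq : ∀ y x, 0 ≤ rBlkWt n Ωc (fineDom n Ωc) y x := rBlkWt_nonneg n Ωc (fineDom n Ωc)
  have hrow : ∀ y, ∑ x, rBlkWt n Ωc (fineDom n Ωc) y x ≤ (n : ℝ) ^ (d + 1) := sum_rBlkWt_row hn Ωc
  have hcol : ∀ x, ∑ y, rBlkWt n Ωc (fineDom n Ωc) y x ≤ 1 := sum_rBlkWt_col n Ωc (fineDom n Ωc)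
  have hTo : ∀ y x, rBlkWt n Ωc (fineDom n Ωc) y x ≠ 0 →
      (transR F κ hn Ωc Ac y x)ᵀ * transR F κ hn Ωc Ac y x = 1 := fun y x _ => transR_orth F κ hn Ωc Ac y x
  have hγ : 0 < min 2 a / 4 + m2 := add_pos_of_pos_of_nonneg (div_pos (lt_min two_pos ha) four_pos) hm
  have hc₁ : 0 < max ((6 * (d + 1) + 2 * m2) / a) 24 := lt_of_lt_of_le (by norm_num) (le_max_right _ _)
  -- (1.8) for the operator (1.6) on Ω, via (1.21) ⇒ (2.23) blockwise
  have hA : ∀ u v : ↥(fineDom n Ωc), v.1 ∈ nbrs u.1 → blk n v.1 = blk n u.1 →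
      |κ * ((fun u v : ↥(fineDom n Ωc) => compField Ac u.1 v.1) u v
        - blockConst n (fineDom n Ωc) (baseConst n Ac) u v)| ≤ θ / n := by
    intro u v hnb hblk
    have hreg := regular17_blockwise hn Ωc hδ h121 u v hnb hblk
    rw [abs_mul]
    exact (mul_le_mul_of_nonneg_left hreg (abs_nonneg κ)).trans hκθ
  have hH : ∀ v, (min 2 a / 4 + m2) * (v ⬝ᵥ v) ≤ v ⬝ᵥ (covOp (regWt n (fineDom n Ωc)) m2
      (a * ((n : ℝ) ^ (d + 1))⁻¹) (rBlkWt n Ωc (fineDom n Ωc)) (linkR F κ n Ωc Ac) (transR F κ hn Ωc Ac) *ᵥ v) := by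
    intro v
    have h := lower18_regular_region_stair F hℓ hLip κ hn ha.le m2 Ωc (baseConst n Ac) hθ hA hsmall v
    rw [b4Op_region_eq] at h
    exact h
  have hunit := isUnit_det_of_form_ge hγ hH
  -- the minimiser Φ⋆ and the energy identity
  set Φ := gStar (regWt n (fineDom n Ωc)) m2 a ((n : ℝ) ^ (d + 1))⁻¹ (rBlkWt n Ωc (fineDom n Ωc))
    (linkR F κ n Ωc Ac) (transR F κ hn Ωc Ac) ψ with hΦ
  have hF := cenergy_gStar hunit ψ
  -- holonomy bound from (1.21)
  have hΛ : ∀ y ∈ Ωc, ∀ μ : Fin (d + 1), y + e1 μ ∈ Ωc → ∀ x, blk n x = y →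
      |κ * loopSum Ac n y μ x| ≤ |κ| * ((3 * d + 4) * n ^ 2 * δ) := by
    intro y hy μ hy' x hx
    rw [abs_mul]
    exact mul_le_mul_of_nonneg_left (abs_loopSum_le hn hδ h121 hx hy hy') (abs_nonneg κ)
  have hE := covDiffSq_le F hLip κ hn Ωc Ac hΛ Φ ψ
  have hM := mass_le hq hs hsN hrow hcol hTo hm Φ ψ
  have hP := gStar_sq_le hq hs hsN hrow hcol hTo hγ hH ψ
  have hFsplit : cenergy (regWt n (fineDom n Ωc)) m2 a ((n : ℝ) ^ (d + 1))⁻¹ (rBlkWt n Ωc (fineDom n Ωc))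
      (linkR F κ n Ωc Ac) (transR F κ hn Ωc Ac) Φ ψ
      = ((n : ℝ) ^ (d + 1))⁻¹ * (Φ ⬝ᵥ (covLap (regWt n (fineDom n Ωc)) (linkR F κ n Ωc Ac) *ᵥ Φ))
        + m2 * (((n : ℝ) ^ (d + 1))⁻¹ * (Φ ⬝ᵥ Φ))
        + a * ((ψ - ((n : ℝ) ^ (d + 1))⁻¹ •
              (avgOp (rBlkWt n Ωc (fineDom n Ωc)) (transR F κ hn Ωc Ac) *ᵥ Φ)) ⬝ᵥ
            (ψ - ((n : ℝ) ^ (d + 1))⁻¹ •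
              (avgOp (rBlkWt n Ωc (fineDom n Ωc)) (transR F κ hn Ωc Ac) *ᵥ Φ))) := by
    rw [cenergy, Matrix.add_mulVec, Matrix.smul_mulVec, Matrix.one_mulVec, dotProduct_add, dotProduct_smul,
      smul_eq_mul]
    ring
  have hK := covLap_form_nonneg_region F κ n Ωc Ac Φ
  have hR : 0 ≤ (ψ - ((n : ℝ) ^ (d + 1))⁻¹ •
        (avgOp (rBlkWt n Ωc (fineDom n Ωc)) (transR F κ hn Ωc Ac) *ᵥ Φ)) ⬝ᵥ
      (ψ - ((n : ℝ) ^ (d + 1))⁻¹ • (avgOp (rBlkWt n Ωc (fineDom n Ωc)) (transR F κ hn Ωc Ac) *ᵥ Φ)) :=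
    dotProduct_self_nonneg' _
  have hP0 : 0 ≤ ((n : ℝ) ^ (d + 1))⁻¹ * (Φ ⬝ᵥ Φ) := mul_nonneg hs (dotProduct_self_nonneg' _)
  have hmain := assemble (D := (d : ℝ) + 1) ha hm hR (mul_nonneg hs hK) hP0 hE hM hFsplit
  -- size of Φ⋆ through (1.8)
  have h6 : 0 ≤ 6 * ((d : ℝ) + 1) * (ℓ * (|κ| * ((3 * d + 4) * n ^ 2 * δ))) ^ 2 := by positivity
  have hmain' := hmain.trans (add_le_add le_rfl (mul_le_mul_of_nonneg_left hP h6))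
  rw [hF] at hmain'
  exact final_step hc₁ hmain' (by ring)

end Lattice

section Family

/-! ## The typed «Proposition 3.1′ of [2]» `B4.Prop31Printed` on the REGULAR-REGION FAMILY

The family is indexed by `(n, Ω^{(k)}, e, A)`: mesh `η = 1/n = L^{-k}` (any `n ≥ 1`), an ARBITRARY finite set
`Ω^{(k)} ⊂ ℤ^{d+1}` of unit labels («Ω a sum of unit blocks»), the charge `e`, and a vector field `A_ν(x)` in component
form on the whole lattice (lattice units: `Ac x ν = A_ν(ηx)`; the link variables are `U(eηA_b) = F.U((e/n)·A_b)`).  The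
flow `F`, the coefficient `a` (the printed `a_k` of (1.14), the `η`-weights of the `L²` pairings being absorbed in
the counting dictionary of `B4Prop31Energy`), `m²`, and the constants `O(1) = C`, `a₀`, `p` of (1.21) are family
parameters. -/

variable {ι : Type} {d : ℕ}

/-- AN INSTANCE of the regular-region family for «Proposition 3.1′ of [2]»: mesh `n ≥ 1`, unit labels `Ω^{(k)}`,
charge `e`, vector field `A_ν(x)` in component form — NO hypothesis (the hypotheses (1.21), `0 < e ≤ e₁` are the
antecedents of `B4.Prop31Printed`). [cite: Balaban1983RegularityDecay, p. 574 (1.21)–(1.22), dictionary] -/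
structure RegularFormInstance (d : ℕ) where
  /-- mesh: `η = 1/n` -/
  n : ℕ
  hn : 1 ≤ n
  /-- the unit labels `Ω^{(k)} ⊂ ℤ^{d+1}` -/
  Ωc : Finset (Fin (d + 1) → ℤ)
  /-- the charge -/
  e : ℝ
  /-- the vector field in component form, lattice units -/
  Ac : (Fin (d + 1) → ℤ) → Fin (d + 1) → ℝ

/-- **THE REGULAR-REGION CARRIERS OF `B4.FormSetting`**: `Cfg := (Ω^{(k)} → ℝ^ι)`; `e :=` the charge; `massSq :=
m²`; `unitBlocks := True` (the fine region IS `fineDom n Ω^{(k)}`, a sum of unit blocks, by construction); `reg121 :=`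
(1.21) «|(∂^η_μA)(x)| ≤ O(1)p(e), p(e) = a₀(1 + log e^{−1})^p» in lattice units on `Ω`:
`|A_ν(x + e_μ) − A_ν(x)| ≤ C·p(e)/n`; `form ψ := ⟨ψ, Δ^{(k)}(Ω,A)ψ⟩` with `Δ^{(k)}(Ω,A) = a − a²η^{d+1}Q G_k(Ω,A) Qᵀ`
(`B4Prop31Energy.keff` of [B4]'s operator (1.6) on `Ω` with `κ = e/n`, Neumann bonds, staircase contours);
`covDiffSq ψ := Σ_{⟨y,y′⟩⊂Ω^{(k)}}|U(A(⟨y,y′⟩))ψ(y′) − ψ(y)|²`; `l2sq ψ := Σ_{y}|ψ(y)|²`.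
[cite: Balaban1983RegularityDecay, p. 574 (1.21)–(1.22) with p. 573 (1.14), dictionary] -/
def regularFormSetting [Fintype ι] [DecidableEq ι] (F : OrthFlow ι) (a m2 C a₀ p : ℝ)
    (i : RegularFormInstance d) : B4.FormSetting where
  Cfg := ↥i.Ωc × ι → ℝ
  e := i.e
  massSq := m2
  unitBlocks := True
  reg121 := ∀ x ∈ fineDom i.n i.Ωc, ∀ μ ν : Fin (d + 1),
    |i.Ac (x + e1 μ) ν - i.Ac x ν| ≤ C * B2.pFn a₀ p i.e / i.n
  form := fun ψ => ψ ⬝ᵥ (keff (regWt i.n (fineDom i.n i.Ωc)) m2 a ((i.n : ℝ) ^ (d + 1))⁻¹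
    (rBlkWt i.n i.Ωc (fineDom i.n i.Ωc)) (linkR F (i.e / i.n) i.n i.Ωc i.Ac)
    (transR F (i.e / i.n) i.hn i.Ωc i.Ac) *ᵥ ψ)
  covDiffSq := covDiffSq F (i.e / i.n) i.Ac i.n i.Ωc
  l2sq := fun ψ => ψ ⬝ᵥ ψ

/-- the carrier's charge is the instance's. [cite: Balaban1983RegularityDecay, p. 574 (1.21), dictionary] -/
theorem regularFormSetting_e [Fintype ι] [DecidableEq ι] (F : OrthFlow ι) (a m2 C a₀ p : ℝ)
    (i : RegularFormInstance d) : (regularFormSetting F a m2 C a₀ p i).e = i.e := rfl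

/-- the carrier's `reg121` reads: (1.21) in lattice units on `Ω`. [cite: Balaban1983RegularityDecay, p. 574 (1.21)] -/
theorem regularFormSetting_reg121_iff [Fintype ι] [DecidableEq ι] (F : OrthFlow ι) (a m2 C a₀ p : ℝ)
    (i : RegularFormInstance d) : (regularFormSetting F a m2 C a₀ p i).reg121 ↔
      ∀ x ∈ fineDom i.n i.Ωc, ∀ μ ν : Fin (d + 1), |i.Ac (x + e1 μ) ν - i.Ac x ν| ≤ C * B2.pFn a₀ p i.e / i.n :=
  Iff.rfl

/-- **THEOREM («PROPOSITION 3.1′ OF [2]» TYPED, ON THE REGULAR-REGION FAMILY: ALL MESHES, ALL FINITE UNIONS OF UNIT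
BLOCKS, ALL CHARGES, ALL VECTOR FIELDS — `A ≠ 0`)**: for a Lipschitz orthogonal flow, `a > 0`, `m² ≥ 0`, `C, a₀ ≥ 0`,
`p > 0`, the verbatim-typed `B4.Prop31Printed` HOLDS on `regularFormSetting F a m² C a₀ p`, with the witnesses `γ₀ =
1/max((6(d+1)+2m²)/a, 24)`, `e₁ = min(1, e₁′)` (`e₁′` from `B4Lower18Regular.threshold_exists` for `c′ =
(d+1)C a₀ max(1,2p)^p`, `β = ½`), and `C(α) = γ₀·6(d+1)(a/γ_H)²·ℓ²((3d+4)C a₀)²·max(1, 2p/α)^{2p}`.  HONEST LABEL: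
`γ₀` depends on `(d, a, m²)` (print: «on d only»); constants and route are the lineage's (module docstring).
[cite: Balaban1983RegularityDecay, Prop. 3.1′ of [2] (1.21)–(1.22) p.574] -/
theorem prop31Printed_regularRegion [Fintype ι] [DecidableEq ι] (F : OrthFlow ι) {ℓ : ℝ} (hℓ : 0 ≤ ℓ)
    (hLip : ∀ t (v : ι → ℝ), ((F.U t - 1) *ᵥ v) ⬝ᵥ ((F.U t - 1) *ᵥ v) ≤ (ℓ * t) ^ 2 * (v ⬝ᵥ v))
    {a : ℝ} (ha : 0 < a) {m2 : ℝ} (hm : 0 ≤ m2) {C : ℝ} (hC : 0 ≤ C) {a₀ : ℝ} (ha₀ : 0 ≤ a₀) {p : ℝ}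
    (hp : 0 < p) : B4.Prop31Printed (regularFormSetting (d := d) F a m2 C a₀ p) := by
  set c₁ : ℝ := max ((6 * (d + 1) + 2 * m2) / a) 24 with hc₁_def
  have hc₁ : 0 < c₁ := lt_of_lt_of_le (by norm_num) (le_max_right _ _)
  set γ : ℝ := min 2 a / 4 + m2 with hγ_def
  have hγ : 0 < γ := add_pos_of_pos_of_nonneg (div_pos (lt_min two_pos ha) four_pos) hm
  set c' : ℝ := (d + 1) * C * (a₀ * max 1 (p / (1 / 2)) ^ p) with hc'
  obtain ⟨e₁, he₁, hsm⟩ := threshold_exists ℓ c' ha (β := (1 / 2 : ℝ)) (by norm_num) d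
  refine ⟨c₁⁻¹, min 1 e₁, inv_pos.2 hc₁, lt_min one_pos he₁, fun α hα => ?_⟩
  set Cα : ℝ := c₁⁻¹ * (6 * (d + 1) * (a / γ) ^ 2 *
    (ℓ ^ 2 * ((3 * d + 4) * C * a₀) ^ 2 * max 1 (2 * p / α) ^ (2 * p))) with hCα
  refine ⟨Cα, by positivity, ?_⟩
  intro i _ hreg he hle ψ
  change 0 < i.e at he
  change i.e ≤ min 1 e₁ at hle
  change ∀ x ∈ fineDom i.n i.Ωc, ∀ μ ν : Fin (d + 1),
    |i.Ac (x + e1 μ) ν - i.Ac x ν| ≤ C * B2.pFn a₀ p i.e / i.n at hreg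
  have he1 : i.e ≤ 1 := hle.trans (min_le_left _ _)
  have hle' : i.e ≤ e₁ := hle.trans (min_le_right _ _)
  have hn0 : (0 : ℝ) < i.n := by exact_mod_cast i.hn
  -- the logarithmic factor of (1.21)
  set Lg : ℝ := 1 + Real.log i.e⁻¹ with hLg
  have hLg0 : 0 ≤ Lg := by
    rw [hLg, Real.log_inv]
    have := Real.log_nonpos he.le he1
    linarith
  have hpFn : B2.pFn a₀ p i.e = a₀ * Lg ^ p := rfl
  rw [hpFn] at hreg
  -- δ, θ
  set δ : ℝ := C * (a₀ * Lg ^ p) / i.n with hδ_def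
  have hδ : 0 ≤ δ := by positivity
  set θ : ℝ := c' * i.e ^ (1 / 2 : ℝ) with hθ_def
  have hθ : 0 ≤ θ := by positivity
  have hlog1 := one_add_log_inv_rpow_mul_rpow_le hp (by norm_num : (0 : ℝ) < 1 / 2) he he1
  have hκ : |i.e / i.n| = i.e / i.n := abs_of_pos (div_pos he hn0)
  have hesplit : i.e = i.e ^ (1 / 2 : ℝ) * i.e ^ (1 / 2 : ℝ) := by
    rw [← Real.rpow_add he]
    norm_num
  have hκθ : |i.e / i.n| * ((d + 1) * i.n * δ) ≤ θ / i.n := by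
    rw [hκ, hδ_def, hθ_def, hc']
    have key : i.e * Lg ^ p ≤ max 1 (p / (1 / 2)) ^ p * i.e ^ (1 / 2 : ℝ) := by
      calc i.e * Lg ^ p = (Lg ^ p * i.e ^ (1 / 2 : ℝ)) * i.e ^ (1 / 2 : ℝ) := by
            conv_lhs => rw [hesplit]
            ring
        _ ≤ max 1 (p / (1 / 2)) ^ p * i.e ^ (1 / 2 : ℝ) :=
            mul_le_mul_of_nonneg_right hlog1 (Real.rpow_nonneg he.le _)
    have hDC : 0 ≤ ((d : ℝ) + 1) * C * a₀ / i.n := by positivity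
    calc i.e / i.n * ((d + 1) * i.n * (C * (a₀ * Lg ^ p) / i.n))
        = (((d : ℝ) + 1) * C * a₀ / i.n) * (i.e * Lg ^ p) := by
          field_simp
      _ ≤ (((d : ℝ) + 1) * C * a₀ / i.n) * (max 1 (p / (1 / 2)) ^ p * i.e ^ (1 / 2 : ℝ)) :=
          mul_le_mul_of_nonneg_left key hDC
      _ = (d + 1) * C * (a₀ * max 1 (p / (1 / 2)) ^ p) * i.e ^ (1 / 2 : ℝ) / i.n := by ring
  have hsmall : ℓ ^ 2 * θ ^ 2 * (d + 1) * (1 + a * (d + 1)) ≤ min 2 a / 4 := hsm i.e he hle'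
  -- the lattice (1.22)
  have key := form122_lattice F hℓ hLip (i.e / i.n) i.hn ha hm i.Ωc i.Ac hδ hθ hreg hκθ hsmall ψ
  rw [← hc₁_def, ← hγ_def] at key
  -- the error coefficient is ≤ C(α) e^{2−α}
  have hω : (ℓ * (|i.e / i.n| * ((3 * d + 4) * i.n ^ 2 * δ))) ^ 2
      = ℓ ^ 2 * ((3 * d + 4) * C * a₀) ^ 2 * (i.e ^ 2 * Lg ^ (2 * p)) := by
    rw [hκ, hδ_def]
    have hsq : (Lg ^ p) ^ 2 = Lg ^ (2 * p) := by
      rw [show (2 : ℝ) * p = p * 2 by ring, Real.rpow_mul hLg0, Real.rpow_two]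
    rw [← hsq]
    field_simp
  have hlog2 := one_add_log_inv_rpow_mul_rpow_le (p := 2 * p) (s := α) (by positivity) hα he he1
  have herr : i.e ^ 2 * Lg ^ (2 * p) ≤ max 1 (2 * p / α) ^ (2 * p) * i.e ^ ((2 : ℝ) - α) := by
    have h2 : i.e ^ 2 = i.e ^ ((2 : ℝ) - α) * i.e ^ α := by
      rw [← Real.rpow_add he, sub_add_cancel, Real.rpow_two]
    rw [h2]
    calc i.e ^ ((2 : ℝ) - α) * i.e ^ α * Lg ^ (2 * p) = (Lg ^ (2 * p) * i.e ^ α) * i.e ^ ((2 : ℝ) - α) := by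
          ring
      _ ≤ max 1 (2 * p / α) ^ (2 * p) * i.e ^ ((2 : ℝ) - α) :=
          mul_le_mul_of_nonneg_right hlog2 (Real.rpow_nonneg he.le _)
  have hcoef : c₁⁻¹ * (6 * (d + 1) * (a / γ) ^ 2 * (ℓ * (|i.e / i.n| * ((3 * d + 4) * i.n ^ 2 * δ))) ^ 2)
      ≤ Cα * i.e ^ ((2 : ℝ) - α) := by
    rw [hω, hCα]
    have h0 : 0 ≤ c₁⁻¹ * (6 * ((d : ℝ) + 1) * (a / γ) ^ 2 * (ℓ ^ 2 * ((3 * d + 4) * C * a₀) ^ 2)) := by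
      positivity
    have := mul_le_mul_of_nonneg_left herr h0
    have e1' : c₁⁻¹ * (6 * ((d : ℝ) + 1) * (a / γ) ^ 2 * (ℓ ^ 2 * ((3 * d + 4) * C * a₀) ^ 2))
        * (i.e ^ 2 * Lg ^ (2 * p))
        = c₁⁻¹ * (6 * (d + 1) * (a / γ) ^ 2 * (ℓ ^ 2 * ((3 * d + 4) * C * a₀) ^ 2 * (i.e ^ 2 * Lg ^ (2 * p)))) := by
      ring
    have e2' : c₁⁻¹ * (6 * ((d : ℝ) + 1) * (a / γ) ^ 2 * (ℓ ^ 2 * ((3 * d + 4) * C * a₀) ^ 2))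
        * (max 1 (2 * p / α) ^ (2 * p) * i.e ^ ((2 : ℝ) - α))
        = c₁⁻¹ * (6 * (d + 1) * (a / γ) ^ 2 *
            (ℓ ^ 2 * ((3 * d + 4) * C * a₀) ^ 2 * max 1 (2 * p / α) ^ (2 * p))) * i.e ^ ((2 : ℝ) - α) := by
      ring
    rw [e1', e2'] at this
    exact this
  have hS : 0 ≤ ψ ⬝ᵥ ψ := dotProduct_self_nonneg' ψ
  have hprod := mul_le_mul_of_nonneg_right hcoef hS
  change c₁⁻¹ * (covDiffSq F (i.e / i.n) i.Ac i.n i.Ωc ψ + m2 * (ψ ⬝ᵥ ψ)) - Cα * i.e ^ ((2 : ℝ) - α) * (ψ ⬝ᵥ ψ)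
    ≤ ψ ⬝ᵥ (keff (regWt i.n (fineDom i.n i.Ωc)) m2 a ((i.n : ℝ) ^ (d + 1))⁻¹
      (rBlkWt i.n i.Ωc (fineDom i.n i.Ωc)) (linkR F (i.e / i.n) i.n i.Ωc i.Ac)
      (transR F (i.e / i.n) i.hn i.Ωc i.Ac) *ᵥ ψ)
  linarith [key, hprod]

/-- «Proposition 3.1′ of [2]» typed on the regular-region family for the ROTATION FLOW (`N = 2`, `U(t) = e^{tq}`,
`q = [[0,−1],[1,0]]`, `ℓ = 1`): a hypothesis-free instance of the flow assumptions.
[cite: Balaban1983RegularityDecay, Prop. 3.1′ of [2] (1.21)–(1.22) p.574] -/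
theorem prop31Printed_regularRegion_rot {a : ℝ} (ha : 0 < a) {m2 : ℝ} (hm : 0 ≤ m2) {C : ℝ} (hC : 0 ≤ C)
    {a₀ : ℝ} (ha₀ : 0 ≤ a₀) {p : ℝ} (hp : 0 < p) :
    B4.Prop31Printed (regularFormSetting (d := d) OrthFlow.rot a m2 C a₀ p) :=
  prop31Printed_regularRegion OrthFlow.rot zero_le_one rot_lipschitz ha hm hC ha₀ hp

end Family

end

end Literature.MathematicalPhysics.QuantumFieldTheory.Balaban1983to89.B4Prop31Regular
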